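import Summits.Ventures.PercRepro.C041TriDomTwoMarkDomination

/-!
# ROW C-041 — THE ASYMMETRIC SHARING S1, part I: the functional, its key inequalities on x-merges, and the merges at an
edge touching the anchor's double-component (p6, gen 48; P6-TWOEXIT-LEAN.md §53 ADDENDUM 22)

Marks: the anchor `a₁ = x` and the exits `u = y`, `u' = z`; patterns `P3 = (x ~ y, x ~ z, y ~ z)`.  S1 is the up-set
statement `#(⊥,s₂) + #(s₁,s₂) + #(s₃,s₂) + #(s₃,s₁) ≤ #(s₂,⊥) + #(⊤,⊥)` (module `C041TriDomSharingS1`); its functional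
`S1F` is `+1` on the right-hand classes and `−1` on the left-hand ones.  THE MECHANISM: an X-MERGE (`XMerge`) is a
single merge of patterns in which `y` and `z` are never joined without `x` — exactly the merges produced by adding an
edge at the anchor's cluster.  On x-merges `S1F` is (i) increasing in the red pattern (`S1F_key1`) and (ii) satisfies
the key inequality `S1F s' t + S1F s t' ≥ S1F s t + S1F s' t'` (`S1F_key2`); both are `decide`s over `P3`, and both
FAIL for the general single merge `⊥ → s₃`.  THE GEOMETRY: `dblCompS st x` is the double-component of `x` (the
vertices reached through double edges — red and blue in every colouring); for a free edge `f` touching it, both ends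
of `f` are connected to `x` under the contraction in both colours (`ends_RdS_double`, `ends_MgS_double`), and by the
one-edge lemma `rtg_or_reach_end` (a walk using `f` reaches an end of `f` without it) the merges of the deletion into
the contraction are x-merges in both colours (`xmerge_rsig`, `xmerge_bsig`).
-/


namespace PercRepro

namespace ZoneZ

namespace MultiExit

open ZoneData Finset

variable {V₁ E₁ U₁ U₂ : Type} (Z₁ : ZoneData V₁ E₁ U₁ U₂) (u u' a₁ : V₁)

/-! ## The sharing functional and its key inequalities -/

/-- The functional of S1 on a pair (red pattern, blue pattern) in the coordinates `(x ~ y, x ~ z, y ~ z)`: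
`+1` on `(s₂,⊥)` and `(⊤,⊥)` (`x ~_R z`, all blue-separated), `−1` on `(⊥,s₂)`, `(s₁,s₂)`, `(s₃,s₂)` (`x ~_B z` only,
`x ≁_R z`) and on `(s₃,s₁)` (`y ~_R z` only, `x ~_B y` only). -/
def S1F (s t : P3) : ℤ :=
  (if s.2.1 = true ∧ t = (false, false, false) then 1 else 0)
    - (if s.2.1 = false ∧ t = (false, true, false) then 1 else 0)
    - (if s = (false, false, true) ∧ t = (true, false, false) then 1 else 0)

/-- An X-MERGE: `s ≤ s'` and `y, z` are joined in `s'` only if they were joined in `s` or `x` is joined to them in `s'`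
(the merges produced by adding an edge at the anchor's cluster). -/
def XMerge (s s' : P3) : Prop := Le3 s s' ∧ (s'.2.2 = true → s.2.2 = true ∨ s'.1 = true)

/-- X-merging is decidable. -/
instance (s s' : P3) : Decidable (XMerge s s') := by unfold XMerge; infer_instance

/-- **Key inequality (i)**: on x-merges `S1F` is increasing in the red pattern. -/
theorem S1F_key1 : ∀ s s' t : P3, Trans3 s ∧ Trans3 s' ∧ Trans3 t ∧ XMerge s s' → S1F s t ≤ S1F s' t := by
  decide

/-- **Key inequality (ii)**: on x-merges in both colours, `S1F s' t + S1F s t' ≥ S1F s t + S1F s' t'`. -/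
theorem S1F_key2 : ∀ s s' t t' : P3, Trans3 s ∧ Trans3 s' ∧ Trans3 t ∧ Trans3 t' ∧ XMerge s s' ∧ XMerge t t' →
    S1F s t + S1F s' t' ≤ S1F s' t + S1F s t' := by
  decide

/-- When the anchor's connections agree in the two colours, every class of S1 is empty. -/
theorem S1F_eq_zero_of_anchor_eq : ∀ s t : P3, s.1 = t.1 → s.2.1 = t.2.1 → S1F s t = 0 := by
  decide

/-- The pointwise inequality of the induction step: the recursion's summands dominate the induction hypothesis's. -/
theorem S1F_ind_ineq (a b : Prop) [Decidable a] [Decidable b] (hba : b → a) (s s' t t' : P3)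
    (hs : Trans3 s) (hs' : Trans3 s') (ht : Trans3 t) (ht' : Trans3 t') (hx : XMerge s s') (hy : XMerge t t') :
    ((if a then S1F s t else 0) + (if b then S1F s' t' else 0) : ℤ) ≤
      (if a then S1F s' t else 0) + (if b then S1F s t' else 0) := by
  have k1 := S1F_key1 s s' t ⟨hs, hs', ht, hx⟩
  have k2 := S1F_key2 s s' t t' ⟨hs, hs', ht, ht', hx, hy⟩
  by_cases ha : a <;> by_cases hb : b
  · simp only [ha, hb, ↓reduceIte]; exact k2
  · simp only [ha, hb, ↓reduceIte, add_zero]; exact k1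
  · exact absurd (hba hb) ha
  · simp only [ha, hb, ↓reduceIte, add_zero, le_refl]

/-! ## The double-component of the anchor -/

/-- Adjacency through a double edge. -/
def dblAdjS (st : E₁ → EStat) (x y : V₁) : Prop := ∃ e, Z₁.Joins e x y ∧ st e = .double

/-- The double-component of `k`: the vertices reached from `k` through double edges. -/
def dblCompS (st : E₁ → EStat) (k : V₁) : Set V₁ := ZoneData.reach (dblAdjS Z₁ st) {k}

/-- A double edge is red under every colouring. -/
theorem dblAdjS_le_RAdjS (st : E₁ → EStat) (ω : E₁ → Bool) (x y : V₁) (h : dblAdjS Z₁ st x y) :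
    RAdjS Z₁ st ω x y := by
  obtain ⟨e, he, hd⟩ := h
  exact ⟨e, he, Or.inl hd⟩

/-- A double edge is blue under every colouring. -/
theorem dblAdjS_le_BAdjS (st : E₁ → EStat) (ω : E₁ → Bool) (x y : V₁) (h : dblAdjS Z₁ st x y) :
    BAdjS Z₁ st ω x y := by
  obtain ⟨e, he, hd⟩ := h
  exact ⟨e, he, Or.inl hd⟩

/-- Members of the double-component are red-connected to its root. -/
theorem RdS_of_mem_dblComp (st : E₁ → EStat) (ω : E₁ → Bool) {k v : V₁} (h : v ∈ dblCompS Z₁ st k) :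
    RdS Z₁ st ω k v :=
  reach_mono (dblAdjS_le_RAdjS Z₁ st ω) h

/-- Members of the double-component are blue-connected to its root. -/
theorem MgS_of_mem_dblComp (st : E₁ → EStat) (ω : E₁ → Bool) {k v : V₁} (h : v ∈ dblCompS Z₁ st k) :
    MgS Z₁ st ω k v :=
  reach_mono (dblAdjS_le_BAdjS Z₁ st ω) h

variable [DecidableEq E₁]

/-- Changing the status of a free edge keeps every double adjacency. -/
theorem dblAdjS_update_of_free {st : E₁ → EStat} {f : E₁} (hf : st f = .free) (s : EStat) {x y : V₁}
    (h : dblAdjS Z₁ st x y) : dblAdjS Z₁ (Function.update st f s) x y := by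
  obtain ⟨e, he, hd⟩ := h
  refine ⟨e, he, ?_⟩
  have hef : e ≠ f := by
    rintro rfl
    rw [hf] at hd
    exact absurd hd (by decide)
  rw [Function.update_of_ne hef]
  exact hd

/-- Changing the status of a free edge keeps the double-component. -/
theorem dblComp_update_of_free {st : E₁ → EStat} {f : E₁} (hf : st f = .free) (s : EStat) {k v : V₁}
    (h : v ∈ dblCompS Z₁ st k) : v ∈ dblCompS Z₁ (Function.update st f s) k :=
  reach_mono (fun _ _ hxy => dblAdjS_update_of_free Z₁ hf s hxy) h

/-! ## One edge: the contraction's adjacency is the deletion's plus the edge -/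

/-- Red adjacency under the contraction of `f`: that of the deletion, or `f` itself. -/
theorem RAdjS_double_iff (st : E₁ → EStat) (f : E₁) (ω : E₁ → Bool) (x y : V₁) :
    RAdjS Z₁ (Function.update st f .double) ω x y ↔
      RAdjS Z₁ (Function.update st f .absent) ω x y ∨ Z₁.Joins f x y := by
  constructor
  · rintro ⟨e, he, hr⟩
    by_cases hef : e = f
    · subst hef; exact Or.inr he
    · exact Or.inl ⟨e, he, by simpa [redE, Function.update_of_ne hef] using hr⟩
  · rintro (⟨e, he, hr⟩ | hj)
    · refine ⟨e, he, ?_⟩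
      by_cases hef : e = f
      · subst hef; simp [redE]
      · simpa [redE, Function.update_of_ne hef] using hr
    · exact ⟨f, hj, by simp [redE]⟩

/-- Blue adjacency under the contraction of `f`: that of the deletion, or `f` itself. -/
theorem BAdjS_double_iff (st : E₁ → EStat) (f : E₁) (ω : E₁ → Bool) (x y : V₁) :
    BAdjS Z₁ (Function.update st f .double) ω x y ↔
      BAdjS Z₁ (Function.update st f .absent) ω x y ∨ Z₁.Joins f x y := by
  constructor
  · rintro ⟨e, he, hb⟩
    by_cases hef : e = f
    · subst hef; exact Or.inr he
    · exact Or.inl ⟨e, he, by simpa [blueE, Function.update_of_ne hef] using hb⟩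
  · rintro (⟨e, he, hb⟩ | hj)
    · refine ⟨e, he, ?_⟩
      by_cases hef : e = f
      · subst hef; simp [blueE]
      · simpa [blueE, Function.update_of_ne hef] using hb
    · exact ⟨f, hj, by simp [blueE]⟩

omit [DecidableEq E₁] in
/-- **The one-edge lemma**: a walk that may use the edge `f` either avoids it, or reaches an end of `f` without it. -/
theorem rtg_or_reach_end {R : V₁ → V₁ → Prop} (f : E₁) {a b : V₁}
    (h : Relation.ReflTransGen (fun x y => R x y ∨ Z₁.Joins f x y) a b) :
    Relation.ReflTransGen R a b ∨ Relation.ReflTransGen R a (Z₁.fst f) ∨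
      Relation.ReflTransGen R a (Z₁.snd f) := by
  induction h with
  | refl => exact Or.inl Relation.ReflTransGen.refl
  | tail _ hcb ih =>
    rcases hcb with hcb | hcb
    · rcases ih with ih | ih | ih
      · exact Or.inl (ih.tail hcb)
      · exact Or.inr (Or.inl ih)
      · exact Or.inr (Or.inr ih)
    · rcases ih with ih | ih | ih
      · rcases hcb with ⟨h1, _⟩ | ⟨_, h2⟩
        · rw [h1]; exact Or.inr (Or.inl ih)
        · rw [h2]; exact Or.inr (Or.inr ih)
      · exact Or.inr (Or.inl ih)
      · exact Or.inr (Or.inr ih)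

/-- Red connectivity under the contraction: under the deletion, or through an end of `f`. -/
theorem RdS_double_cases (st : E₁ → EStat) (f : E₁) (ω : E₁ → Bool) (a b : V₁)
    (h : RdS Z₁ (Function.update st f .double) ω a b) :
    RdS Z₁ (Function.update st f .absent) ω a b ∨ RdS Z₁ (Function.update st f .absent) ω a (Z₁.fst f) ∨
      RdS Z₁ (Function.update st f .absent) ω a (Z₁.snd f) := by
  unfold RdS at h ⊢
  rw [mem_reach_singleton] at h
  rw [mem_reach_singleton, mem_reach_singleton, mem_reach_singleton]
  have h' : Relation.ReflTransGen
      (fun x y => RAdjS Z₁ (Function.update st f .absent) ω x y ∨ Z₁.Joins f x y) a b :=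
    Relation.ReflTransGen.mono (fun x y hxy => (RAdjS_double_iff Z₁ st f ω x y).mp hxy) a b h
  exact rtg_or_reach_end Z₁ f h'

/-- Blue connectivity under the contraction: under the deletion, or through an end of `f`. -/
theorem MgS_double_cases (st : E₁ → EStat) (f : E₁) (ω : E₁ → Bool) (a b : V₁)
    (h : MgS Z₁ (Function.update st f .double) ω a b) :
    MgS Z₁ (Function.update st f .absent) ω a b ∨ MgS Z₁ (Function.update st f .absent) ω a (Z₁.fst f) ∨
      MgS Z₁ (Function.update st f .absent) ω a (Z₁.snd f) := by
  unfold MgS at h ⊢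
  rw [mem_reach_singleton] at h
  rw [mem_reach_singleton, mem_reach_singleton, mem_reach_singleton]
  have h' : Relation.ReflTransGen
      (fun x y => BAdjS Z₁ (Function.update st f .absent) ω x y ∨ Z₁.Joins f x y) a b :=
    Relation.ReflTransGen.mono (fun x y hxy => (BAdjS_double_iff Z₁ st f ω x y).mp hxy) a b h
  exact rtg_or_reach_end Z₁ f h'

/-- Red connectivity under the deletion implies it under the contraction (any two vertices). -/
theorem RdS_absent_le_double_S1 (st : E₁ → EStat) (f : E₁) (ω : E₁ → Bool) {a b : V₁}
    (h : RdS Z₁ (Function.update st f .absent) ω a b) : RdS Z₁ (Function.update st f .double) ω a b :=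
  reach_mono (fun x y hxy => (RAdjS_double_iff Z₁ st f ω x y).mpr (Or.inl hxy)) h

/-- Blue connectivity under the deletion implies it under the contraction (any two vertices). -/
theorem MgS_absent_le_double_S1 (st : E₁ → EStat) (f : E₁) (ω : E₁ → Bool) {a b : V₁}
    (h : MgS Z₁ (Function.update st f .absent) ω a b) : MgS Z₁ (Function.update st f .double) ω a b :=
  reach_mono (fun x y hxy => (BAdjS_double_iff Z₁ st f ω x y).mpr (Or.inl hxy)) h

omit [DecidableEq E₁] in
/-- Red connectivity is symmetric. -/
theorem RdS_symm_S1 (st : E₁ → EStat) (ω : E₁ → Bool) {a b : V₁} (h : RdS Z₁ st ω a b) : RdS Z₁ st ω b a :=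
  reach_trans_of_symm (RAdjS_symm Z₁ st ω) h (mem_reach_self _ _)

omit [DecidableEq E₁] in
/-- Blue connectivity is symmetric. -/
theorem MgS_symm_S1 (st : E₁ → EStat) (ω : E₁ → Bool) {a b : V₁} (h : MgS Z₁ st ω a b) : MgS Z₁ st ω b a :=
  reach_trans_of_symm (BAdjS_symm Z₁ st ω) h (mem_reach_self _ _)

/-! ## The merges at an edge touching the anchor's double-component are x-merges -/

/-- Both ends of a free edge touching the double-component of `a₁` are red-connected to `a₁` under the contraction. -/
theorem ends_RdS_double {st : E₁ → EStat} {f : E₁} (hf : st f = .free)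
    (hT : Z₁.fst f ∈ dblCompS Z₁ st a₁ ∨ Z₁.snd f ∈ dblCompS Z₁ st a₁) (ω : E₁ → Bool) :
    RdS Z₁ (Function.update st f .double) ω a₁ (Z₁.fst f) ∧
      RdS Z₁ (Function.update st f .double) ω a₁ (Z₁.snd f) := by
  have hfs : RAdjS Z₁ (Function.update st f .double) ω (Z₁.fst f) (Z₁.snd f) :=
    ⟨f, Or.inl ⟨rfl, rfl⟩, by simp [redE]⟩
  have hsf : RAdjS Z₁ (Function.update st f .double) ω (Z₁.snd f) (Z₁.fst f) := RAdjS_symm Z₁ _ _ _ _ hfs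
  rcases hT with hT | hT
  · have h1 : RdS Z₁ (Function.update st f .double) ω a₁ (Z₁.fst f) :=
      RdS_of_mem_dblComp Z₁ _ ω (dblComp_update_of_free Z₁ hf .double hT)
    refine ⟨h1, ?_⟩
    unfold RdS at h1 ⊢
    rw [mem_reach_singleton] at h1 ⊢
    exact h1.tail hfs
  · have h2 : RdS Z₁ (Function.update st f .double) ω a₁ (Z₁.snd f) :=
      RdS_of_mem_dblComp Z₁ _ ω (dblComp_update_of_free Z₁ hf .double hT)
    refine ⟨?_, h2⟩
    unfold RdS at h2 ⊢
    rw [mem_reach_singleton] at h2 ⊢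
    exact h2.tail hsf

/-- Both ends of a free edge touching the double-component of `a₁` are blue-connected to `a₁` under the contraction. -/
theorem ends_MgS_double {st : E₁ → EStat} {f : E₁} (hf : st f = .free)
    (hT : Z₁.fst f ∈ dblCompS Z₁ st a₁ ∨ Z₁.snd f ∈ dblCompS Z₁ st a₁) (ω : E₁ → Bool) :
    MgS Z₁ (Function.update st f .double) ω a₁ (Z₁.fst f) ∧
      MgS Z₁ (Function.update st f .double) ω a₁ (Z₁.snd f) := by
  have hfs : BAdjS Z₁ (Function.update st f .double) ω (Z₁.fst f) (Z₁.snd f) :=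
    ⟨f, Or.inl ⟨rfl, rfl⟩, by simp [blueE]⟩
  have hsf : BAdjS Z₁ (Function.update st f .double) ω (Z₁.snd f) (Z₁.fst f) := BAdjS_symm Z₁ _ _ _ _ hfs
  rcases hT with hT | hT
  · have h1 : MgS Z₁ (Function.update st f .double) ω a₁ (Z₁.fst f) :=
      MgS_of_mem_dblComp Z₁ _ ω (dblComp_update_of_free Z₁ hf .double hT)
    refine ⟨h1, ?_⟩
    unfold MgS at h1 ⊢
    rw [mem_reach_singleton] at h1 ⊢
    exact h1.tail hfs
  · have h2 : MgS Z₁ (Function.update st f .double) ω a₁ (Z₁.snd f) :=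
      MgS_of_mem_dblComp Z₁ _ ω (dblComp_update_of_free Z₁ hf .double hT)
    refine ⟨?_, h2⟩
    unfold MgS at h2 ⊢
    rw [mem_reach_singleton] at h2 ⊢
    exact h2.tail hsf

/-- The red pattern of the deletion refines that of the contraction. -/
theorem le3_rsig_S1 (st : E₁ → EStat) (f : E₁) (ω : E₁ → Bool) :
    Le3 (rsig Z₁ u u' a₁ (Function.update st f .absent) ω) (rsig Z₁ u u' a₁ (Function.update st f .double) ω) := by
  simp only [Le3, rsig, decide_eq_true_eq]
  exact ⟨fun h => RdS_absent_le_double_S1 Z₁ st f ω h, fun h => RdS_absent_le_double_S1 Z₁ st f ω h,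
    fun h => RdS_absent_le_double_S1 Z₁ st f ω h⟩

/-- The blue pattern of the deletion refines that of the contraction. -/
theorem le3_bsig_S1 (st : E₁ → EStat) (f : E₁) (ω : E₁ → Bool) :
    Le3 (bsig Z₁ u u' a₁ (Function.update st f .absent) ω) (bsig Z₁ u u' a₁ (Function.update st f .double) ω) := by
  simp only [Le3, bsig, decide_eq_true_eq]
  exact ⟨fun h => MgS_absent_le_double_S1 Z₁ st f ω h, fun h => MgS_absent_le_double_S1 Z₁ st f ω h,
    fun h => MgS_absent_le_double_S1 Z₁ st f ω h⟩

/-- **The red merge at an edge touching the anchor's double-component is an x-merge.** -/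
theorem xmerge_rsig {st : E₁ → EStat} {f : E₁} (hf : st f = .free)
    (hT : Z₁.fst f ∈ dblCompS Z₁ st a₁ ∨ Z₁.snd f ∈ dblCompS Z₁ st a₁) (ω : E₁ → Bool) :
    XMerge (rsig Z₁ u u' a₁ (Function.update st f .absent) ω)
      (rsig Z₁ u u' a₁ (Function.update st f .double) ω) := by
  refine ⟨le3_rsig_S1 Z₁ u u' a₁ st f ω, ?_⟩
  simp only [rsig, decide_eq_true_eq]
  intro hyz
  obtain ⟨he1, he2⟩ := ends_RdS_double Z₁ a₁ hf hT ω
  rcases RdS_double_cases Z₁ st f ω u u' hyz with h | h | h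
  · exact Or.inl h
  · right
    have h' := RdS_symm_S1 Z₁ _ ω (RdS_absent_le_double_S1 Z₁ st f ω h)
    exact reach_trans' he1 h'
  · right
    have h' := RdS_symm_S1 Z₁ _ ω (RdS_absent_le_double_S1 Z₁ st f ω h)
    exact reach_trans' he2 h'

/-- **The blue merge at an edge touching the anchor's double-component is an x-merge.** -/
theorem xmerge_bsig {st : E₁ → EStat} {f : E₁} (hf : st f = .free)
    (hT : Z₁.fst f ∈ dblCompS Z₁ st a₁ ∨ Z₁.snd f ∈ dblCompS Z₁ st a₁) (ω : E₁ → Bool) :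
    XMerge (bsig Z₁ u u' a₁ (Function.update st f .absent) ω)
      (bsig Z₁ u u' a₁ (Function.update st f .double) ω) := by
  refine ⟨le3_bsig_S1 Z₁ u u' a₁ st f ω, ?_⟩
  simp only [bsig, decide_eq_true_eq]
  intro hyz
  obtain ⟨he1, he2⟩ := ends_MgS_double Z₁ a₁ hf hT ω
  rcases MgS_double_cases Z₁ st f ω u u' hyz with h | h | h
  · exact Or.inl h
  · right
    have h' := MgS_symm_S1 Z₁ _ ω (MgS_absent_le_double_S1 Z₁ st f ω h)
    exact reach_trans' he1 h'
  · right
    have h' := MgS_symm_S1 Z₁ _ ω (MgS_absent_le_double_S1 Z₁ st f ω h)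
    exact reach_trans' he2 h'


end MultiExit

end ZoneZ

end PercRepro
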